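import Mathlib
import Summits.ValiantsHypothesis.ValiantsHypothesis.Theorems.NewtonUnitEquationsTwoProductsRankOneFourLawPlanar
import HarnessLib

/-!
# `relation_ladder` — R7 sketch: LARGE RELATION COEFFICIENTS ARE PERMUTATION TYPE (proved) + the typed R7 target
(val-idea-8 g3, 2026-08-28).  Typed target only — NOT a rung, NOT in the cone of `Lines/relation_ladder.lean`.

`permType_of_rankOne_largeCoeff`: if all coincidences of the letter family `A : Fin m → Finset Expo` are multiples of one relation
`ρ⁺ ~ ρ⁻` and some letter carries a coefficient `> m` on one side and `0` on the other, then NO genuine coincidence exists (a tuple has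
at most `m` letters, `msetT_apply_le`), i.e. the family is of permutation type and R3♯ (`permTypeLaw_proof`) already counts it.
Consequence for the ladder: in every rank-one rung the relation may be assumed to have all coefficients `≤ m` (uniformity of the
shift-rank / slice bounds in the coefficients `p, q, r, …` is therefore never an issue).

`RankOneSupportLaw U`: the general single-relation law for relations supported on `≤ U` letters (R6 = pattern `(1,1;1,1)`, R6b =
`(1;1,1)`, R6c = `(2;1,1)` are its first three instances); see `Lines/relation_ladder_R7_engine.md` for the TRANSPORTATION LIFT that is
expected to prove it for every fixed `U` with the two landed tools (`BinExpSum.binExpPencilCount`, `ShiftRank.pencilCount`).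
-/

namespace Summit.ValiantsHypothesis.ValiantsHypothesis.Theorems.NewtonUnitEquations.TwoProducts.PermutationType

open MvPolynomial
open Summit.ValiantsHypothesis.ValiantsHypothesis.Theorems.NewtonUnitEquations.TwoProducts.FormalLogLinearisation
open Summit.ValiantsHypothesis.ValiantsHypothesis.Theorems.NewtonUnitEquations.TwoProducts.PlanarCell

variable {m : ℕ}

/-- A `0`-filled letter tuple of length `m` uses every letter at most `m` times. -/
theorem msetT_apply_le (a : Fin m → Expo) (e : Expo) : msetT a e ≤ m := by
  classical
  unfold msetT
  rw [Finsupp.finsetSum_apply]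
  calc ∑ j, ((if a j = 0 then (0 : Expo →₀ ℕ) else Finsupp.single (a j) 1) e)
      ≤ ∑ _j : Fin m, 1 := Finset.sum_le_sum fun j _ => by
        split_ifs with h
        · simp
        · rw [Finsupp.single_apply]; split_ifs <;> simp
    _ = m := by simp

/-- **LARGE COEFFICIENTS ARE PERMUTATION TYPE.**  If the coincidences of `A` are rank one with relation `ρ⁺ ~ ρ⁻` and some letter `e`
has coefficient `> m` on one side of the relation and `0` on the other, then `A` is of permutation type. -/
theorem permType_of_rankOne_largeCoeff (A : Fin m → Finset Expo) (ρp ρm : Expo →₀ ℕ) (e : Expo)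
    (h : RankOneCoincidences A ρp ρm) (hl : (m < ρp e ∧ ρm e = 0) ∨ (m < ρm e ∧ ρp e = 0)) : PermType A := by
  intro a ha b hb hab
  obtain ⟨k, hk⟩ := h a ha b hb hab
  have hae := msetT_apply_le a e
  have hbe := msetT_apply_le b e
  rcases Nat.eq_zero_or_pos k with rfl | hk0
  · rcases hk with hk | hk
    · simpa using hk
    · simpa using hk.symm
  · exfalso
    rcases hk with hk | hk
    · have h1 := congrArg (fun f : Expo →₀ ℕ => f e) hk
      simp only [Finsupp.add_apply, Finsupp.smul_apply, smul_eq_mul] at h1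
      rcases hl with ⟨hp, hm0⟩ | ⟨hm, hp0⟩
      · rw [hm0, mul_zero, add_zero] at h1
        have : ρp e ≤ k * ρp e := Nat.le_mul_of_pos_left _ hk0
        omega
      · rw [hp0, mul_zero, add_zero] at h1
        have : ρm e ≤ k * ρm e := Nat.le_mul_of_pos_left _ hk0
        omega
    · have h1 := congrArg (fun f : Expo →₀ ℕ => f e) hk
      simp only [Finsupp.add_apply, Finsupp.smul_apply, smul_eq_mul] at h1
      rcases hl with ⟨hp, hm0⟩ | ⟨hm, hp0⟩
      · rw [hm0, mul_zero, add_zero] at h1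
        have : ρp e ≤ k * ρp e := Nat.le_mul_of_pos_left _ hk0
        omega
      · rw [hp0, mul_zero, add_zero] at h1
        have : ρm e ≤ k * ρm e := Nat.le_mul_of_pos_left _ hk0
        omega

/-- Corollary in the form the rungs use: for a relation with DISJOINT sides, rank one with some coefficient `> m` is permutation type. -/
theorem permType_of_rankOne_disjoint_largeCoeff (A : Fin m → Finset Expo) (ρp ρm : Expo →₀ ℕ)
    (hdisj : Disjoint ρp.support ρm.support) (h : RankOneCoincidences A ρp ρm) (e : Expo)
    (hl : m < ρp e ∨ m < ρm e) : PermType A := by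
  refine permType_of_rankOne_largeCoeff A ρp ρm e h ?_
  rcases hl with hp | hm
  · refine Or.inl ⟨hp, ?_⟩
    have hep : e ∈ ρp.support := Finsupp.mem_support_iff.mpr (by omega)
    exact Finsupp.notMem_support_iff.mp (Finset.disjoint_left.mp hdisj hep)
  · refine Or.inr ⟨hm, ?_⟩
    have hem : e ∈ ρm.support := Finsupp.mem_support_iff.mpr (by omega)
    exact Finsupp.notMem_support_iff.mp (Finset.disjoint_right.mp hdisj hem)

/-- **R7 (typed target): the single-relation law for relations on `≤ U` letters.**  If every additive coincidence of the letter
family is a multiple of ONE relation `ρ⁺ ~ ρ⁻` with disjoint sides supported on at most `U` letters in total, then GLOBALLY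
`#visible ≤ 2^{c m}(#T+2)^c` with `c = c(U)`.  Instances: R6 (`ρ⁺ = e_γ+e_δ`, `ρ⁻ = e_α+e_β`), R6b (`e_β+e_γ ~ e_α`), R6c (`2e_β ~ e_α+e_γ`). -/
def RankOneSupportLaw (U : ℕ) : Prop :=
  ∃ c : ℕ, ∀ (m : ℕ) (u v : Fin m → MvPolynomial (Fin 2) ℂ), (∀ j, coeff 0 (u j) = 0) → (∀ j, coeff 0 (v j) = 0) →
    (∃ ρp ρm : Expo →₀ ℕ, Disjoint ρp.support ρm.support ∧ (ρp.support ∪ ρm.support).card ≤ U ∧ 0 ∉ ρp.support ∧ 0 ∉ ρm.support ∧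
      RankOneCoincidences (fun j => (u j).support ∪ (v j).support) ρp ρm) →
    ∀ S : Finset Expo, (∀ l ∈ S, ∃ ξ : Fin 2 → ℝ, ValidWeight u v ξ ∧ IsStrictTop ξ ↑(tailDiff u v).support l) →
      S.card ≤ 2 ^ (c * m) * ((tailSupport u v).card + 2) ^ c

end Summit.ValiantsHypothesis.ValiantsHypothesis.Theorems.NewtonUnitEquations.TwoProducts.PermutationType
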